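import Summits.Ventures.PercRepro.S4MidKeyTenTwelveC1

/-!
# PercRepro — THE MIDDLE KEY AT LEVEL `10`, RANK `12` (p1 g47, S4 feeder — p9 owns SUBCLAIM-S4; no window claim here)

Part of the middle key at rank `12`, level `10` (n₀ = 649, 4 layers; p1 g47): the certificate of proofs/P1-HYPKEY.md §16 split into a chain of
explicit linear forms by layers and by size so that every `linear_combination` stays under the gate's 600-second verification limit (§16 (e)).
Nothing is claimed below `n₀`. Axioms: standard.
-/

open scoped Matroid

namespace PercRepro

namespace S4Mid

open Set Finset S2LP S3Mid

variable {α : Type}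

set_option maxHeartbeats 64000000 in
set_option maxRecDepth 20000 in
set_option linter.unusedSimpArgs false in
/-- **THE MIDDLE KEY AT RANK `12`, LEVEL `10`** (4 layers = ranks `10 … 11`): `RLS M 12 10` for every `e`-free `M` on `n ≥ 649` points (`d ≥ 637`). -/
theorem c025_core_ten_midkey_twelve (M : Matroid α) [M.Finite] (hn : 649 ≤ M.E.ncard)
    (hfree : ∀ e ∈ M.E, ∃ A ⊆ M.E \ {e}, e ∉ M.closure A ∧ e ∉ M.closure ((M.E \ {e}) \ A)) :
    ThmN.RLS M 12 10 := by
  classical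
  have h639 : ∀ X ⊆ M.E, M.eRk X ≤ ((10 : ℕ) : ℕ∞) → X.ncard ≤ 639 :=
    fun X hX h => ThmN.ncard_le_six_thirty_nine_of_eRk_le_ten_of_free M hfree X hX (by exact_mod_cast h)
  have hphi : phiK 12 10 = 12 / 11 := by
    rw [HypKey.phiK_eq_two_pow_sub 12 10 (by norm_num), Nat.choose_symm_add]
    simp only [Finset.sum_range_succ, Finset.sum_range_zero]
    norm_num [Nat.choose_eq_descFactorial_div_factorial, Nat.descFactorial_succ, Nat.descFactorial_zero, Nat.factorial]
  have hTopU : Matroid.topCount M 12 10 ≤ ∑ i ∈ Finset.range 630, (uSets M 12 10 (10 + i)).ncard := by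
    rw [topCount_eq_sum_uSets, ← S3LP.sum_Icc_eq_sum_range (fun k => (uSets M 12 10 k).ncard) 10 639]
    refine le_of_eq (Finset.sum_subset ?_ ?_).symm
    · intro k hk
      simp only [Finset.mem_Icc] at hk
      simp only [Finset.mem_range]
      omega
    · intro k _ hk
      simp only [Finset.mem_Icc, not_and_or, not_le] at hk
      have h1 := ncard_uSets_le_rkSets (M := M) 12 10 k
      rcases hk with hk | hk
      · rw [S3LP.z_lt k 10 hk] at h1; omega
      · rw [rkSets_eq_empty_of_flat h639 le_rfl hk, Set.ncard_empty] at h1; omega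
  have hTop : Matroid.topCount M 12 10 ≤ ∑ i ∈ Finset.range 630, (S1.rkSets M (10 + i) 10).ncard :=
    hTopU.trans (Finset.sum_le_sum fun i _ => ncard_uSets_le_rkSets (M := M) 12 10 (10 + i))
  have hY := S3LP.yRow (M := M) 10 12
  have hPrev1 := c025_core_ten_midkey_twelve_c1 M hn hfree
  simp only [rminL, Finset.sum_range_succ, Finset.sum_range_zero, Nat.reduceAdd, Nat.reduceSub, Nat.reduceMul, Nat.reduceEqDiff, Nat.reduceLeDiff, ↓reduceIte, zero_add, add_zero, zero_mul, mul_zero, one_mul, mul_one, Nat.add_sub_cancel] at hTop hY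
  rw [ThmN.RLS_iff, hphi]
  qify at hTop hY
  have hn0 : ∀ s : Set (Set α), (0 : ℚ) ≤ (s.ncard : ℚ) := fun s => Nat.cast_nonneg _
  have N : ∀ k r : ℕ, (0 : ℚ) ≤ ((S1.rkSets M k r).ncard : ℚ) := fun k r => hn0 _
  linear_combination (12 / 11 * hTop + ((-1) * hY + 1 * hPrev1))

end S4Mid

end PercRepro
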